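import Literature.Probability.RandomPlanarGeometry.SAWBridgeRenewalEquation
import Literature.Probability.RandomPlanarGeometry.SAWBridgeUpperBound
import HarnessLib

/-!
# Diamond points of bridges (Duminil-Copin–Hammond 2013, §2.3 / §4): cones, diamond times, and their
# abundance from cone positivity

Topic `Literature/Probability/RandomPlanarGeometry` (continues `SAWBridges.lean`, `SAWSubBallistic.lean`
(`Zd.IsRenewalTime`), `SAWBridgeRenewalEquation.lean` (`Zd.concatWalk` gluing of bridges)).

Source: H. Duminil-Copin, A. Hammond, *Self-avoiding walk is sub-ballistic*, Comm. Math. Phys. 324 (2013)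
401–423, arXiv:1205.0401 [DuminilCopinHammond2013]. §2.3 (arXiv v1, p. 9): "The point `γ_i` is a
diamond point of `γ` if – for any `j ≥ i`, `(x+y)(γ_j) ≥ (x+y)(γ_i)` and `(y−x)(γ_j) ≥ (y−x)(γ_i)`, – for
any `j ≤ i`, `(x+y)(γ_j) ≤ (x+y)(γ_i)` and `(y−x)(γ_j) ≤ (y−x)(γ_i)`. Note that a diamond point is indeed a
renewal point." §4, Proposition 4.2 (arXiv v1, p. 20): under `E_iSAB|γ| < ∞` diamond points have positive
density among renewal points, `P^{⊗ℕ}_iSAB`-a.s. (printed proof: ergodic theorem for the bi-infinite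
renewal measure, Lemma 4.1).

This file is the HYPOTHESIS-FREE combinatorial layer of the tree's proof of DCH Theorem 2.5
(`E_iSAB|γ| = ∞`; file `SAWBridgeNoRenewal.lean`), in the tree's coordinates (`y` = coordinate `0` =
the bridge direction of `Zd.IsBridge`, `x` = coordinate `1`; the site lattice `ℤ^{d+2}`):
* `Zd.InNorthCone u := |u 1| ≤ u 0`, `Zd.InSouthCone u := u 0 ≤ -|u 1|` — the printed cone conditions;
* `Zd.northConeBridges d k` / `Zd.southConeBridges d k` — `k`-step bridges lying in the north cone of the
  start / the south cone of the end;
* `Zd.IsDiamondTime N γ t` — DEVIATION from print: we REQUIRE `t` to be a renewal time and add the two cone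
  conditions (in `d = 2` the printed definition implies the renewal property; in `d ≥ 3` it does not —
  `γ_j = γ_i + e_3` is allowed by the printed cones — and the proof only ever uses diamond points that are
  renewal points); `Zd.diamondTimes N γ`; `Zd.xDev N γ = max_{j ≤ N} |x(γ_j)|` (DCH's `width ≤ 2·xDev`);
* `Zd.card_mul_card_le_card_filter_isDiamondTime` — gluing a south-cone bridge and a north-cone bridge
  gives a bridge with a diamond time at the gluing time (injectively): `#S_t · #N_{N−t} ≤ #{γ ∈ B_N : t
  diamond}`;
* `Zd.sum_card_diamondTimes_eq` — double counting `Σ_{γ ∈ B_N} #D(γ) = Σ_{t ≤ N} #{γ ∈ B_N : t diamond}`;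
* **`Zd.exists_frac_bridges_many_diamondTimes`** — if `#N_k, #S_k ≥ ρ μ^k` for `k ≥ k₀` (cone positivity,
  proved under `E_iSAB|γ| < ∞` in `SAWBridgeNoRenewal.lean`) then for `N ≥ 4k₀` at least `(ρ²/4)·b_N`
  bridges of length `N` have at least `(ρ²/4)·N` diamond times. DEVIATION from print (Prop. 4.2): the
  printed statement is an almost-sure density under `P^{⊗ℕ}_iSAB` obtained from the ergodic theorem on the
  bi-infinite measure; here the density is obtained IN EXPECTATION under the uniform law on `B_N` by the
  split bijection `{γ ∈ B_N, t renewal} ≅ B_t × B_{N−t}` and converted by Markov's inequality — which is all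
  the stickbreak argument needs.
-/

noncomputable section

open Finset Literature.Probability.LatticeModels Literature.Probability.Percolation
open scoped BigOperators

namespace Literature.Probability.RandomPlanarGeometry.SAW.Zd

variable {d : ℕ}

/-! ### Cones -/

/-- `u` lies in the closed north cone `{y ≥ |x|}` (`y` = coordinate `0`, `x` = coordinate `1`):
the printed "`(x+y)(u) ≥ 0` and `(y−x)(u) ≥ 0`". [cite: DuminilCopinHammond2013, §2.3 (arXiv v1, p. 9)] -/
def InNorthCone (u : Site (d + 2)) : Prop := |u 1| ≤ u 0

/-- `u` lies in the closed south cone `{y ≤ -|x|}`: the printed "`(x+y)(u) ≤ 0` and `(y−x)(u) ≤ 0`".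
[cite: DuminilCopinHammond2013, §2.3 (arXiv v1, p. 9)] -/
def InSouthCone (u : Site (d + 2)) : Prop := u 0 ≤ -|u 1|

/-- `0` is in the north cone. [cite: DuminilCopinHammond2013, §2.3] -/
theorem inNorthCone_zero : InNorthCone (0 : Site (d + 2)) := by simp [InNorthCone]

/-- `0` is in the south cone. [cite: DuminilCopinHammond2013, §2.3] -/
theorem inSouthCone_zero : InSouthCone (0 : Site (d + 2)) := by simp [InSouthCone]

/-- In the north cone the height is nonnegative. [cite: DuminilCopinHammond2013, §2.3] -/
theorem InNorthCone.nonneg {u : Site (d + 2)} (h : InNorthCone u) : 0 ≤ u 0 := (abs_nonneg _).trans h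

/-- In the south cone the height is nonpositive. [cite: DuminilCopinHammond2013, §2.3] -/
theorem InSouthCone.nonpos {u : Site (d + 2)} (h : InSouthCone u) : u 0 ≤ 0 :=
  h.trans (neg_nonpos.2 (abs_nonneg _))

open Classical in
/-- The `k`-step bridges all of whose sites lie in the north cone of the starting point `0`.
[cite: DuminilCopinHammond2013, §4, proof of Proposition 4.2 (arXiv v1, pp. 20–21)] -/
def northConeBridges (d k : ℕ) : Finset (ℕ → Site (d + 2)) :=
  (bridges (d + 2) k).filter fun τ => ∀ j ≤ k, InNorthCone (τ j)

open Classical in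
/-- The `k`-step bridges all of whose sites lie in the south cone of the endpoint.
[cite: DuminilCopinHammond2013, §4, proof of Proposition 4.2 (arXiv v1, pp. 20–21)] -/
def southConeBridges (d k : ℕ) : Finset (ℕ → Site (d + 2)) :=
  (bridges (d + 2) k).filter fun η => ∀ j ≤ k, InSouthCone (η j - η k)

/-- Membership in `northConeBridges`. [cite: DuminilCopinHammond2013, §4] -/
theorem mem_northConeBridges {k : ℕ} {τ : ℕ → Site (d + 2)} :
    τ ∈ northConeBridges d k ↔ τ ∈ bridges (d + 2) k ∧ ∀ j ≤ k, InNorthCone (τ j) := by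
  classical
  exact mem_filter

/-- Membership in `southConeBridges`. [cite: DuminilCopinHammond2013, §4] -/
theorem mem_southConeBridges {k : ℕ} {η : ℕ → Site (d + 2)} :
    η ∈ southConeBridges d k ↔ η ∈ bridges (d + 2) k ∧ ∀ j ≤ k, InSouthCone (η j - η k) := by
  classical
  exact mem_filter

/-- North-cone bridges are bridges. [cite: DuminilCopinHammond2013, §4] -/
theorem northConeBridges_subset (k : ℕ) : northConeBridges d k ⊆ bridges (d + 2) k := by
  classical
  exact filter_subset _ _

/-- South-cone bridges are bridges. [cite: DuminilCopinHammond2013, §4] -/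
theorem southConeBridges_subset (k : ℕ) : southConeBridges d k ⊆ bridges (d + 2) k := by
  classical
  exact filter_subset _ _

/-! ### Diamond times -/

/-- **Diamond time** `t` of an `N`-step walk `γ`: a renewal time whose past lies in the south cone of
`γ_t` and whose future (up to time `N`) lies in the north cone of `γ_t` (DCH's "diamond point `γ_t`";
the renewal property is part of the definition here, see the module docstring).
[cite: DuminilCopinHammond2013, §2.3 (arXiv v1, p. 9)] -/
def IsDiamondTime (N : ℕ) (γ : ℕ → Site (d + 2)) (t : ℕ) : Prop :=
  IsRenewalTime N γ t ∧ (∀ j ≤ t, InSouthCone (γ j - γ t)) ∧ ∀ j, t ≤ j → j ≤ N → InNorthCone (γ j - γ t)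

/-- A diamond time is a renewal time. [cite: DuminilCopinHammond2013, §2.3 ("a diamond point is indeed a renewal point")] -/
theorem IsDiamondTime.isRenewalTime {N t : ℕ} {γ : ℕ → Site (d + 2)} (h : IsDiamondTime N γ t) :
    IsRenewalTime N γ t := h.1

/-- A diamond time is at most `N`. [cite: DuminilCopinHammond2013, §2.3] -/
theorem IsDiamondTime.le {N t : ℕ} {γ : ℕ → Site (d + 2)} (h : IsDiamondTime N γ t) : t ≤ N := h.1.1

open Classical in
/-- The set `D_γ` of diamond times of an `N`-step walk. [cite: DuminilCopinHammond2013, §4 (arXiv v1, p. 20, `D_γ`)] -/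
def diamondTimes (N : ℕ) (γ : ℕ → Site (d + 2)) : Finset ℕ := (range (N + 1)).filter (IsDiamondTime N γ)

/-- Membership in `diamondTimes`. [cite: DuminilCopinHammond2013, §4] -/
theorem mem_diamondTimes {N t : ℕ} {γ : ℕ → Site (d + 2)} : t ∈ diamondTimes N γ ↔ IsDiamondTime N γ t := by
  classical
  rw [diamondTimes, mem_filter, mem_range]
  exact ⟨fun h => h.2, fun h => ⟨Nat.lt_succ_of_le h.le, h⟩⟩

/-- There are at most `N + 1` diamond times. [cite: DuminilCopinHammond2013, §4] -/
theorem card_diamondTimes_le (N : ℕ) (γ : ℕ → Site (d + 2)) : #(diamondTimes N γ) ≤ N + 1 := by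
  classical
  rw [diamondTimes]
  exact (card_filter_le _ _).trans (card_range _).le

/-- Horizontal deviation `max_{j ≤ N} |x(γ_j)|` of an `N`-step walk (the printed `width(γ) =
max |x(γ_i) − x(γ_j)|` is at most twice it). [cite: DuminilCopinHammond2013, §4, proof of Theorem 2.5 (arXiv v1, p. 22, `width`)] -/
def xDev (N : ℕ) (γ : ℕ → Site (d + 2)) : ℕ := (range (N + 1)).sup fun j => (γ j 1).natAbs

/-- `|x(γ_j)| ≤ xDev` for `j ≤ N`. [cite: DuminilCopinHammond2013, §4] -/
theorem natAbs_le_xDev {N j : ℕ} (γ : ℕ → Site (d + 2)) (hj : j ≤ N) : (γ j 1).natAbs ≤ xDev N γ :=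
  le_sup (f := fun j => (γ j 1).natAbs) (mem_range.2 (Nat.lt_succ_of_le hj))

/-- `|x(γ_j)| ≤ xDev` for `j ≤ N`, integer form. [cite: DuminilCopinHammond2013, §4] -/
theorem abs_le_xDev {N j : ℕ} (γ : ℕ → Site (d + 2)) (hj : j ≤ N) : |γ j 1| ≤ (xDev N γ : ℤ) := by
  rw [Int.abs_eq_natAbs]
  exact_mod_cast natAbs_le_xDev γ hj

/-- `xDev ≤ w` iff every `|x(γ_j)| ≤ w`. [cite: DuminilCopinHammond2013, §4] -/
theorem xDev_le_iff {N w : ℕ} {γ : ℕ → Site (d + 2)} : xDev N γ ≤ w ↔ ∀ j ≤ N, |γ j 1| ≤ (w : ℤ) := by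
  rw [xDev, Finset.sup_le_iff]
  constructor
  · intro h j hj
    rw [Int.abs_eq_natAbs]
    exact_mod_cast h j (mem_range.2 (Nat.lt_succ_of_le hj))
  · intro h j hj
    have := h j (Nat.le_of_lt_succ (mem_range.1 hj))
    rw [Int.abs_eq_natAbs] at this
    exact_mod_cast this

/-! ### Gluing cone bridges produces diamond times -/

/-- **Gluing an `t`-step south-cone bridge and an `(N−t)`-step north-cone bridge gives an `N`-step bridge
with a diamond time at `t`.** [cite: DuminilCopinHammond2013, §4, proof of Proposition 4.2 (arXiv v1, pp. 20–21)] -/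
theorem isDiamondTime_concatWalk {N t : ℕ} (htN : t ≤ N) {η τ : ℕ → Site (d + 2)}
    (hη : η ∈ southConeBridges d t) (hτ : τ ∈ northConeBridges d (N - t)) :
    IsDiamondTime N (concatWalk t η τ) t := by
  obtain ⟨hηb, hηc⟩ := mem_southConeBridges.1 hη
  obtain ⟨hτb, hτc⟩ := mem_northConeBridges.1 hτ
  have hτ0 : τ 0 = 0 := (mem_saws.1 (mem_bridges.1 hτb).1).1
  refine ⟨isRenewalTime_concatWalk htN hηb hτb, fun j hj => ?_, fun j htj hjN => ?_⟩
  · rw [concatWalk_apply_of_le η τ hj, concatWalk_apply_of_le η τ le_rfl]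
    exact hηc j hj
  · obtain ⟨i, rfl⟩ := Nat.exists_eq_add_of_le htj
    rw [concatWalk_apply_add η τ hτ0, concatWalk_apply_of_le η τ le_rfl, add_sub_cancel_left]
    exact hτc i (by omega)

open Classical in
/-- **`#S_t · #N_{N−t} ≤ #{γ ∈ B_N : t is a diamond time of γ}`** (the gluing map is injective).
[cite: DuminilCopinHammond2013, §4, proof of Proposition 4.2 (arXiv v1, pp. 20–21)] -/
theorem card_mul_card_le_card_filter_isDiamondTime {N t : ℕ} (htN : t ≤ N) :
    #(southConeBridges d t) * #(northConeBridges d (N - t)) ≤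
      #((bridges (d + 2) N).filter fun γ => IsDiamondTime N γ t) := by
  classical
  rw [← card_product]
  refine card_le_card_of_injOn (fun p => concatWalk t p.1 p.2) (fun p hp => ?_) (fun p hp p' hp' h => ?_)
  · rw [mem_coe, mem_product] at hp
    rw [mem_coe, mem_filter]
    exact ⟨concatWalk_mem_bridges htN (southConeBridges_subset _ hp.1) (northConeBridges_subset _ hp.2),
      isDiamondTime_concatWalk htN hp.1 hp.2⟩
  · rw [mem_coe, mem_product] at hp hp'
    have h1 := (mem_bridges.1 (southConeBridges_subset _ hp.1)).1
    have h2 := (mem_bridges.1 (northConeBridges_subset _ hp.2)).1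
    have h1' := (mem_bridges.1 (southConeBridges_subset _ hp'.1)).1
    have h2' := (mem_bridges.1 (northConeBridges_subset _ hp'.2)).1
    obtain ⟨e1, e2⟩ := concatWalk_injective_pieces h1 h2 h1' h2' h
    exact Prod.ext e1 e2

open Classical in
/-- **Double counting**: `Σ_{γ ∈ B_N} #D(γ) = Σ_{t ≤ N} #{γ ∈ B_N : t is a diamond time of γ}`.
[cite: DuminilCopinHammond2013, §4] -/
theorem sum_card_diamondTimes_eq (N : ℕ) :
    ∑ γ ∈ bridges (d + 2) N, #(diamondTimes N γ) =
      ∑ t ∈ range (N + 1), #((bridges (d + 2) N).filter fun γ => IsDiamondTime N γ t) := by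
  classical
  simp only [diamondTimes, card_filter]
  exact sum_comm

/-! ### Abundance of diamond times from cone positivity -/

/-- **Diamond times are abundant** (the tree's replacement for DCH Proposition 4.2): if for all `k ≥ k₀`
at least `ρ μ^k` of the `k`-step bridges lie in the north cone of their start and at least `ρ μ^k` in the
south cone of their end, then for every `N ≥ 4k₀` at least `(ρ²/4)·b_N` of the `N`-step bridges have at
least `(ρ²/4)·N` diamond times. Proof: `Σ_γ #D(γ) ≥ Σ_{k₀ ≤ t ≤ N−k₀} ρ² μ^N ≥ (N+1−2k₀) ρ² b_N` by the two
previous lemmas and `b_N ≤ μ^N`, then Markov's inequality with `#D(γ) ≤ N+1`.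
[cite: DuminilCopinHammond2013, §4, Proposition 4.2 (arXiv v1, p. 20; here in expectation under the uniform law on `B_N`)] -/
theorem exists_frac_bridges_many_diamondTimes {ρ : ℝ} (hρ : 0 < ρ) {k₀ : ℕ}
    (hcone : ∀ k ≥ k₀, ρ * connectiveConstant (d + 2) ^ k ≤ #(northConeBridges d k) ∧
      ρ * connectiveConstant (d + 2) ^ k ≤ #(southConeBridges d k)) :
    ∃ c : ℝ, 0 < c ∧ ∃ N₀ : ℕ, ∀ N ≥ N₀,
      c * bridgeCount (d + 2) N ≤ #((bridges (d + 2) N).filter fun γ => c * N ≤ (#(diamondTimes N γ) : ℝ)) := by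
  classical
  refine ⟨ρ ^ 2 / 4, by positivity, 4 * k₀, fun N hN => ?_⟩
  set μ := connectiveConstant (d + 2) with hμ
  have hμpos : 0 < μ := connectiveConstant_pos _
  set c : ℝ := ρ ^ 2 / 4 with hc
  -- Step 1: the expected number of diamond times
  have hsum : ((N : ℝ) + 1 - 2 * k₀) * ρ ^ 2 * μ ^ N ≤
      ∑ γ ∈ bridges (d + 2) N, (#(diamondTimes N γ) : ℝ) := by
    have h1 : ∀ t ∈ Icc k₀ (N - k₀), ρ ^ 2 * μ ^ N ≤
        (#((bridges (d + 2) N).filter fun γ => IsDiamondTime N γ t) : ℝ) := by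
      intro t ht
      rw [mem_Icc] at ht
      have htN : t ≤ N := by omega
      have hS := (hcone t ht.1).2
      have hNt := (hcone (N - t) (by omega)).1
      have hcard := card_mul_card_le_card_filter_isDiamondTime (d := d) htN
      have hcard' : (#(southConeBridges d t) : ℝ) * #(northConeBridges d (N - t)) ≤
          #((bridges (d + 2) N).filter fun γ => IsDiamondTime N γ t) := by exact_mod_cast hcard
      have hpow : μ ^ N = μ ^ t * μ ^ (N - t) := by rw [← pow_add, Nat.add_sub_cancel' htN]
      calc ρ ^ 2 * μ ^ N = (ρ * μ ^ t) * (ρ * μ ^ (N - t)) := by rw [hpow]; ring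
        _ ≤ (#(southConeBridges d t) : ℝ) * #(northConeBridges d (N - t)) := by
            gcongr
        _ ≤ _ := hcard'
    have h2 : ∑ t ∈ Icc k₀ (N - k₀), (#((bridges (d + 2) N).filter fun γ => IsDiamondTime N γ t) : ℝ) ≤
        ∑ t ∈ range (N + 1), (#((bridges (d + 2) N).filter fun γ => IsDiamondTime N γ t) : ℝ) := by
      refine sum_le_sum_of_subset_of_nonneg (fun t ht => ?_) (fun _ _ _ => by positivity)
      rw [mem_Icc] at ht
      exact mem_range.2 (by omega)
    have h3 : ((N : ℝ) + 1 - 2 * k₀) * ρ ^ 2 * μ ^ N ≤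
        ∑ t ∈ Icc k₀ (N - k₀), (#((bridges (d + 2) N).filter fun γ => IsDiamondTime N γ t) : ℝ) := by
      have hcard : #(Icc k₀ (N - k₀)) = N + 1 - 2 * k₀ := by rw [Nat.card_Icc]; omega
      have : ((N : ℝ) + 1 - 2 * k₀) = ((N + 1 - 2 * k₀ : ℕ) : ℝ) := by
        rw [Nat.cast_sub (by omega)]; push_cast; ring
      rw [this]
      calc ((N + 1 - 2 * k₀ : ℕ) : ℝ) * ρ ^ 2 * μ ^ N = ∑ _t ∈ Icc k₀ (N - k₀), ρ ^ 2 * μ ^ N := by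
            rw [sum_const, hcard, nsmul_eq_mul]; ring
        _ ≤ _ := sum_le_sum h1
    have h4 : (∑ γ ∈ bridges (d + 2) N, (#(diamondTimes N γ) : ℝ)) =
        ∑ t ∈ range (N + 1), (#((bridges (d + 2) N).filter fun γ => IsDiamondTime N γ t) : ℝ) := by
      exact_mod_cast sum_card_diamondTimes_eq (d := d) N
    rw [h4]
    exact h3.trans h2
  -- Step 2: Markov
  set A := (bridges (d + 2) N).filter fun γ => c * N ≤ (#(diamondTimes N γ) : ℝ) with hA
  have hsplit : ∑ γ ∈ bridges (d + 2) N, (#(diamondTimes N γ) : ℝ) ≤ ((N : ℝ) + 1) * #A + c * N * bridgeCount (d + 2) N := by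
    have hle : ∀ γ ∈ bridges (d + 2) N, (#(diamondTimes N γ) : ℝ) ≤
        ((N : ℝ) + 1) * (if c * N ≤ (#(diamondTimes N γ) : ℝ) then 1 else 0) + c * N := by
      intro γ _
      split_ifs with hγ
      · have := card_diamondTimes_le N γ
        have : (#(diamondTimes N γ) : ℝ) ≤ N + 1 := by exact_mod_cast this
        linarith [show (0 : ℝ) ≤ c * N by positivity]
      · linarith [not_le.1 hγ]
    calc ∑ γ ∈ bridges (d + 2) N, (#(diamondTimes N γ) : ℝ)
        ≤ ∑ γ ∈ bridges (d + 2) N, (((N : ℝ) + 1) * (if c * N ≤ (#(diamondTimes N γ) : ℝ) then 1 else 0) + c * N) :=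
          sum_le_sum hle
      _ = ((N : ℝ) + 1) * #A + c * N * bridgeCount (d + 2) N := by
          rw [sum_add_distrib, ← mul_sum, sum_boole, sum_const, nsmul_eq_mul, bridgeCount, hA]
          ring
  have hb : (bridgeCount (d + 2) N : ℝ) ≤ μ ^ N := bridgeCount_le_pow N
  have hN' : (4 * k₀ : ℝ) ≤ N := by exact_mod_cast hN
  -- combine: (N+1) #A ≥ ((N+1-2k₀)ρ² - cN) b_N ≥ (N+1) c b_N
  have key : ((N : ℝ) + 1) * (c * bridgeCount (d + 2) N) ≤ ((N : ℝ) + 1) * #A := by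
    have h1 : ((N : ℝ) + 1 - 2 * k₀) * ρ ^ 2 * bridgeCount (d + 2) N ≤
        ((N : ℝ) + 1 - 2 * k₀) * ρ ^ 2 * μ ^ N := by
      have : (0 : ℝ) ≤ ((N : ℝ) + 1 - 2 * k₀) * ρ ^ 2 := by nlinarith [sq_nonneg ρ]
      exact mul_le_mul_of_nonneg_left hb this
    have hbN : (0 : ℝ) ≤ bridgeCount (d + 2) N := by positivity
    have eq1 : ((N : ℝ) + 1 - 2 * k₀) * ρ ^ 2 * bridgeCount (d + 2) N - c * N * bridgeCount (d + 2) N ≤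
        ((N : ℝ) + 1) * #A := by linarith [hsum, hsplit, h1]
    have hprod : (0 : ℝ) ≤ ρ ^ 2 * bridgeCount (d + 2) N * ((N : ℝ) - 4 * k₀) :=
      mul_nonneg (mul_nonneg (sq_nonneg ρ) hbN) (by linarith)
    have eq2 : ((N : ℝ) + 1) * (c * bridgeCount (d + 2) N) ≤
        ((N : ℝ) + 1 - 2 * k₀) * ρ ^ 2 * bridgeCount (d + 2) N - c * N * bridgeCount (d + 2) N := by
      rw [hc]
      nlinarith [hprod, mul_nonneg (sq_nonneg ρ) hbN]
    exact eq2.trans eq1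
  have hN1 : (0 : ℝ) < (N : ℝ) + 1 := by positivity
  exact le_of_mul_le_mul_left key hN1

end Literature.Probability.RandomPlanarGeometry.SAW.Zd

end
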